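import Summits.ResolutionOfSingularities.ResolutionOfSingularities.Theorems.FrobeniusLadderFInjectiveMacaulayficationWildPinchCylinderAxisGood
import Summits.ResolutionOfSingularities.ResolutionOfSingularities.Theorems.FrobeniusLadderFInjectiveMacaulayficationWildPinchCylinderAxisCentre
import Summits.ResolutionOfSingularities.ResolutionOfSingularities.Theorems.FrobeniusLadderFInjectiveMacaulayficationRelClosedFixFalse
import Literature.AlgebraicGeometry.Resolution.ProjectiveSpaceRegular
import Mathlib.AlgebraicGeometry.IdealSheaf.Functorial
import HarnessLib

/-!
# WITNESS 2 (d4) COMPLETE: `goodOver_IC_off_origin` hypothesis-free, and the three relative-fix statements REFUTED unconditionally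
# (crux `FInjectiveMacaulayfication` stmt-ResolutionOfSingularities-15315, chain w45a; res-L1-w45a-plan-1 R16.49/R16.50; seat res-L1-w45a-stub-2; the
# centre regularity in ring form is res-L1-w45a-stub-3's p579282 `…WildPinchCylinderAxisCentre`)

[OURS · L1 W4.5a] Support file (`--supports stmt-ResolutionOfSingularities-15315 --as helper`); NOT a statement of any manuscript; def-free, UNCONDITIONAL;
AI-written (AI review is weaker than expert review). It REFUTES typed candidate statements of OURS (not of any manuscript).

§1 `isRegular_centre_subscheme`: the restricted centre `(I_C|_{D(t̄)}).subscheme` is a regular scheme — the affine piece of Mathlib's `subschemeCover` at `⊤` is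
`Spec (Γ(D(t̄), ⊤) ⧸ (I_C|_{D(t̄)})(⊤)) ≅ Spec (Γ(X₁, D(t̄)) ⧸ I_C(D(t̄)))` (`ideal_comap_of_isOpenImmersion`, `Scheme.Opens.ι_image_top`), a regular ring by
stub-3's `WildPinchCylinderAxisCentre.isRegularRing_sections_basicOpen_quotient_IC`. §2 `goodOver_IC_off_origin` = p579312's
`goodOver_IC_off_origin_of_isRegular_centre` with `hC` discharged (the two presentations of `D(t̄)` agree: `basicOpen_eq_of_affine`).
§3 `relClosedSubsetFixPow_false`, `relClosedSubsetFixFinite_false`, `relClosedSubsetFix_false` — UNCONDITIONAL, by stub-3's `RelClosedFixFalse.…_of_goodOverIC`.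
[cite: Liu2002, Thm. 8.1.19 (a)] [cite: GortzWedhorn2020, Prop. 13.91]
-/

-- single-problem summit: the doubled namespace component is forced
set_option linter.dupNamespace false

noncomputable section

namespace Summit.ResolutionOfSingularities.ResolutionOfSingularities.Theorems.FInjectiveMacaulayfication.WildPinchCylinderAxisGoodFinal

open CategoryTheory AlgebraicGeometry TopologicalSpace IsLocalRing MvPolynomial
open Literature.AlgebraicGeometry.Resolution
open Summit.ResolutionOfSingularities.ResolutionOfSingularities.Theorems.FInjectiveMacaulayfication
open FCUnguardedAprime SliceableCentre

variable (k : Type) [Field k] [CharP k 2] (F : MvPolynomial (Fin 5) k) (hF : F = X 2 ^ 2 + X 0 ^ 2 * X 1 * X 2 + X 0 * X 1 ^ 2)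

/-! ## §1 The restricted centre `C ∩ D(t̄)` is a regular scheme -/

set_option maxHeartbeats 800000 in -- long concrete statement; no change of meaning
omit [CharP k 2] in
include hF in
/-- **The restricted centre `(I_C|_{D(t̄)}).subscheme` is regular** (its affine model is `Spec (Γ(X₁, D(t̄)) ⧸ I_C(D(t̄))) ≅ Spec k[t, t⁻¹]`,
a regular ring by `WildPinchCylinderAxisCentre.isRegularRing_sections_basicOpen_quotient_IC`). [cite: Liu2002, Thm. 8.1.19 (a)] -/
theorem isRegular_centre_subscheme' :
    Scheme.IsRegular (((Scheme.IdealSheafData.ofIdealTop (((Ideal.span (MvPolynomial.X '' ({0, 2, 3, 4} : Set (Fin 5)) : Set (MvPolynomial (Fin 5) k))).map (Ideal.Quotient.mk (Ideal.span {F}))).map (Scheme.ΓSpecIso (.of (MvPolynomial (Fin 5) k ⧸ Ideal.span {F}))).inv.hom)) : (Spec (.of (MvPolynomial (Fin 5) k ⧸ Ideal.span {F}))).IdealSheafData).comap (Scheme.Opens.ι ((Spec (.of (MvPolynomial (Fin 5) k ⧸ Ideal.span {F}))).basicOpen ((Scheme.ΓSpecIso (.of (MvPolynomial (Fin 5) k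 ⧸ Ideal.span {F}))).inv (Ideal.Quotient.mk (Ideal.span {F}) (X 1)))))).subscheme := by
  -- names
  let X₁ : Scheme.{0} := (Spec (.of (MvPolynomial (Fin 5) k ⧸ Ideal.span {F})))
  let W : X₁.Opens := ((Spec (.of (MvPolynomial (Fin 5) k ⧸ Ideal.span {F}))).basicOpen ((Scheme.ΓSpecIso (.of (MvPolynomial (Fin 5) k ⧸ Ideal.span {F}))).inv (Ideal.Quotient.mk (Ideal.span {F}) (X 1))))
  let I : X₁.IdealSheafData := ((Scheme.IdealSheafData.ofIdealTop (((Ideal.span (MvPolynomial.X '' ({0, 2, 3, 4} : Set (Fin 5)) : Set (MvPolynomial (Fin 5) k))).map (Ideal.Quotient.mk (Ideal.span {F}))).map (Scheme.ΓSpecIso (.of (MvPolynomial (Fin 5) k ⧸ Ideal.span {F}))).inv.hom)) : (Spec (.of (MvPolynomial (Fin 5) k ⧸ Ideal.span {F}))).IdealSheafData)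
  have hWaff : IsAffineOpen W := (isAffineOpen_top X₁).basicOpen _
  haveI : IsAffine (W : Scheme.{0}) := hWaff
  let J : (W : Scheme.{0}).IdealSheafData := I.comap W.ι
  change Scheme.IsRegular J.subscheme
  -- the affine piece of the canonical cover at `⊤`
  let U : (W : Scheme.{0}).affineOpens := ⟨⊤, isAffineOpen_top _⟩
  -- its ring is `Γ(X₁, W) ⧸ I(W)` up to the isomorphism `W.ι.appIso ⊤`
  have hring : IsRegularRing (Γ((W : Scheme.{0}), (U : (W : Scheme.{0}).Opens)) ⧸ J.ideal U) := by
    let V : X₁.affineOpens := ⟨W.ι ''ᵁ (U : (W : Scheme.{0}).Opens), U.2.image_of_isOpenImmersion W.ι⟩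
    have hV : V = ⟨W, hWaff⟩ := Subtype.ext (Scheme.Opens.ι_image_top W)
    have key : ∀ V' : X₁.affineOpens, V' = ⟨W, hWaff⟩ → IsRegularRing (Γ(X₁, (V' : X₁.Opens)) ⧸ I.ideal V') := by
      rintro V' rfl
      exact WildPinchCylinderAxisCentre.isRegularRing_sections_basicOpen_quotient_IC k F hF
    haveI hV' : IsRegularRing (Γ(X₁, (V : X₁.Opens)) ⧸ I.ideal V) := key V hV
    let φ : Γ(X₁, (V : X₁.Opens)) ≃+* Γ((W : Scheme.{0}), (U : (W : Scheme.{0}).Opens)) :=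
      (W.ι.appIso (U : (W : Scheme.{0}).Opens)).commRingCatIsoToRingEquiv
    have hJ : J.ideal U = (I.ideal V).map (φ : _ →+* _) := by
      rw [Ideal.map_comap_of_equiv, Scheme.IdealSheafData.ideal_comap_of_isOpenImmersion]
      rfl
    exact IsRegularRing.of_ringEquiv (Ideal.quotientEquiv (I.ideal V) (J.ideal U) φ hJ)
  -- hence the cover piece is a regular scheme, and it covers the subscheme
  refine Scheme.IsRegular.of_forall_exists_isOpenImmersion fun z => ⟨_, J.subschemeCover.f U, inferInstance, ?_, ?_⟩
  · rw [← Scheme.Hom.coe_opensRange, Scheme.IdealSheafData.opensRange_subschemeCover_map]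
    trivial
  · haveI : IsRegularRing (J.subschemeCover.X U) := hring
    exact Scheme.isRegular_Spec _

omit [CharP k 2] in
include hF in
/-- The same for the `PrimeSpectrum.basicOpen` presentation of `D(t̄)` used in `WildPinchCylinderAxisGood` (the two opens coincide, `basicOpen_eq_of_affine`).
[plumbing] -/
theorem isRegular_centre_subscheme :
    Scheme.IsRegular (((Scheme.IdealSheafData.ofIdealTop (((Ideal.span (MvPolynomial.X '' ({0, 2, 3, 4} : Set (Fin 5)) : Set (MvPolynomial (Fin 5) k))).map (Ideal.Quotient.mk (Ideal.span {F}))).map (Scheme.ΓSpecIso (.of (MvPolynomial (Fin 5) k ⧸ Ideal.span {F}))).inv.hom)) : (Spec (.of (MvPolynomial (Fin 5) k ⧸ Ideal.span {F}))).IdealSheafData).comap (Scheme.Opens.ι (⟨(PrimeSpectrum.basicOpen (Ideal.Quotient.mk (Ideal.span {F}) (X 1)) : Set (PrimeSpectrum (MvPolynomial (Fin 5) k ⧸ Ideal.span {F}))), PrimeSpectrum.isOpen_basicOpen⟩ : (Spec (.of (MvPolynomial (Fin 5) k ⧸ Ideal.span {F}))).Opens))).subscheme := by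
  have hW : ((Spec (.of (MvPolynomial (Fin 5) k ⧸ Ideal.span {F}))).basicOpen ((Scheme.ΓSpecIso (.of (MvPolynomial (Fin 5) k ⧸ Ideal.span {F}))).inv (Ideal.Quotient.mk (Ideal.span {F}) (X 1)))) = (⟨(PrimeSpectrum.basicOpen (Ideal.Quotient.mk (Ideal.span {F}) (X 1)) : Set (PrimeSpectrum (MvPolynomial (Fin 5) k ⧸ Ideal.span {F}))), PrimeSpectrum.isOpen_basicOpen⟩ : (Spec (.of (MvPolynomial (Fin 5) k ⧸ Ideal.span {F}))).Opens) := basicOpen_eq_of_affine _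
  exact hW ▸ isRegular_centre_subscheme' k F hF

/-! ## §2 (d4) hypothesis-free -/

include hF in
/-- **(d4) `goodOver_IC_off_origin`**: every blow-up of the wild-pinch cylinder `X₁` along the `t`-axis ideal `I_C` is GOOD (FULL at non-closed, CM at closed
points) over `supp I_C ∖ {b}`. [OURS · unconditional] [cite: Liu2002, Thm. 8.1.19 (a)] -/
theorem goodOver_IC_off_origin (b : (Spec (.of (MvPolynomial (Fin 5) k ⧸ Ideal.span {F})))) (hb : b.asIdeal = ((Ideal.span (MvPolynomial.X '' (Set.univ : Set (Fin 5)) : Set (MvPolynomial (Fin 5) k))).map (Ideal.Quotient.mk (Ideal.span {F})))) :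
    GoodOver 2 (Spec (.of (MvPolynomial (Fin 5) k ⧸ Ideal.span {F}))) ((Scheme.IdealSheafData.ofIdealTop (((Ideal.span (MvPolynomial.X '' ({0, 2, 3, 4} : Set (Fin 5)) : Set (MvPolynomial (Fin 5) k))).map (Ideal.Quotient.mk (Ideal.span {F}))).map (Scheme.ΓSpecIso (.of (MvPolynomial (Fin 5) k ⧸ Ideal.span {F}))).inv.hom)) : (Spec (.of (MvPolynomial (Fin 5) k ⧸ Ideal.span {F}))).IdealSheafData) ((((Scheme.IdealSheafData.ofIdealTop (((Ideal.span (MvPolynomial.X '' ({0, 2, 3, 4} : Set (Fin 5)) : Set (MvPolynomial (Fin 5) k))).map (Ideal.Quotient.mk (Ideal.span {F}))).map (Scheme.ΓSpecIso (.of (MvPolynomial (Fin 5) k ⧸ Ideal.span {F}))).inv.hom)) : (Spec (.of (MvPolynomial (Fin 5) k ⧸ Ideal.span {F}))).IdealSheafData).support : Set (Spec (.of (MvPolynomial (Fin 5) k ⧸ Ideal.span {F})))) \ {b}) :=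
  WildPinchCylinderAxisGood.goodOver_IC_off_origin_of_isRegular_centre k F hF b hb (isRegular_centre_subscheme k F hF)

/-! ## §3 The relative-fix candidates, refuted unconditionally -/

/-- **`RelClosedSubsetFixPow` is FALSE** (WITNESS 2: the wild-pinch cylinder, `J₀ = I_C`). [OURS · refutation of our own candidate statement] -/
theorem relClosedSubsetFixPow_false : ¬ FCUnguardedAprime.RelClosedSubsetFixPow :=
  RelClosedFixFalse.relClosedSubsetFixPow_false_of_goodOverIC fun k _ _ F hF b hb => goodOver_IC_off_origin k F hF b hb

/-- **`RelClosedSubsetFixFinite` is FALSE** (WITNESS 2). [OURS · refutation of our own candidate statement] -/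
theorem relClosedSubsetFixFinite_false : ¬ RelClosedSubsetFixFinite.RelClosedSubsetFixFinite :=
  RelClosedFixFalse.relClosedSubsetFixFinite_false_of_goodOverIC fun k _ _ F hF b hb => goodOver_IC_off_origin k F hF b hb

/-- **`RelClosedSubsetFix` is FALSE** (WITNESS 2). [OURS · refutation of our own candidate statement] -/
theorem relClosedSubsetFix_false : ¬ FCUnguardedAprime.RelClosedSubsetFix :=
  RelClosedFixFalse.relClosedSubsetFix_false_of_goodOverIC fun k _ _ F hF b hb => goodOver_IC_off_origin k F hF b hb

end Summit.ResolutionOfSingularities.ResolutionOfSingularities.Theorems.FInjectiveMacaulayfication.WildPinchCylinderAxisGoodFinal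

end
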